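import Summits.BirchSwinnertonDyer.BirchSwinnertonDyer.Theorems.PrintX10bStubReadoutSelmer
import Summits.BirchSwinnertonDyer.BirchSwinnertonDyer.Theorems.UniversalToricDescentTwinReadoutSelmerAtP
import HarnessLib

/-!
# (B4) per place for a curve MULTIPLICATIVE above `p` (`p` odd), with NO cite-only leaf: the readout of an `F_𝔮`-local class
# satisfies the local condition of `Sel_{p^∞}(E/K_∞)` at every finite place (helper, theorems only; no definition, no named fact,
# no instance, no `sorry`)

LEAD `bsd-wall-utd-p1` (g26), crux r205 stmt-BirchSwinnertonDyer-24737 `UniversalToricDescent.TwinAlgMuZeroAtThree`, line `beta-road` v10,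
K2 stub `stub_howardOutputsOfFamily`, D1-twin controls, letter (B4) `readoutSelmer`: the per-place theorem of x10b-p2 g8's
`PrintX10bStubReadoutSelmer` §1 is re-run for a curve with MULTIPLICATIVE reduction at the places above `p` — the print frame's
`IsOrdinaryAt W p` + cite-only Greenberg leaf (CG) are replaced, in the `v ∣ p` branch only, by the PROVED multiplicative Greenberg
inclusion (`UniversalToricDescentTwinReadoutSelmerAtP`, p763953 ← p763876); the branches `v ∈ S, v ∤ p` (saturated unramified ⇒ GV p. 17)
and `v ∉ S` (Milne I.3.8 / GV p. 17) are x10b's verbatim (generic in the curve).  For the twin of crux 24737 (`Rank1Residual.Mult W′ 3`)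
`hmultp` is `UniversalToricDescentTwinTateLineAtThree.hasMultiplicativeReductionAt_baseChange_of_mult_three`.  What is NOT here: the
letter-level assembly (`Stmt.readoutSelmer` is phrased on the print frame `Thm413Hypotheses`; the twin's ControlGlue letters are not yet
written).  BSD is proved for no curve by any of this; 24737 stays OPEN.
-/

set_option linter.dupNamespace false
set_option autoImplicit false

noncomputable section

open scoped Classical Pointwise ContRepresentation TensorProduct NumberField

open Function NumberField IsDedekindDomain Field
open Literature Literature.NumberTheory.EllipticCurves WeierstrassCurve
open Literature.NumberTheory.GaloisCohomology Literature.NumberTheory.GaloisCohomology.Howard2004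
open Literature.NumberTheory.GaloisRepresentations Literature.NumberTheory.GaloisRepresentations.DiscreteGaloisModule
open Literature.NumberTheory.EllipticCurves.GreenbergSelmer
open Summit.BirchSwinnertonDyer.BirchSwinnertonDyer.Theorems

namespace Summit.BirchSwinnertonDyer.BirchSwinnertonDyer.Theorems.UniversalToricDescentTwinReadoutSelmerPerPlace

/-! ## The readout of an `F_𝔮`-local class satisfies the local condition of `Sel_{p^∞}(E/K_∞)` (all finite places) -/

section PerPlace

open Literature.NumberTheory.EllipticCurves.ZpExtension (EisensteinLevel)

variable {K : Type} [Field K] [NumberField K] (W : WeierstrassCurve ℚ) [W.IsElliptic]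
  {p : ℕ} [hp : Fact p.Prime] (κ : ZpExtension K p) {m : ℕ} (hm : 1 ≤ m)

variable (π : IwasawaAlgebra p ⧸ Ideal.span {(PowerSeries.X ^ m + PowerSeries.C (p : ℤ_[p]) : IwasawaAlgebra p)})
  (e : ℕ → ℕ)
  (hkill : letI := IwasawaAlgebra.isLocalRing_quotient_X_pow_add_C p hm
    ∀ k, ∀ r ∈ IsLocalRing.maximalIdeal
      (IwasawaAlgebra p ⧸ Ideal.span {(PowerSeries.X ^ m + PowerSeries.C (p : ℤ_[p]) : IwasawaAlgebra p)}) ^ e k,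
      ∀ x : EisensteinLevel p m (fun j ↦ geomTorsion (W.baseChange K) ((p : ℤ) ^ j)) (k + 1), r • x = 0)
  (hker : letI := IwasawaAlgebra.isLocalRing_quotient_X_pow_add_C p hm
    ∀ k, LinearMap.ker ((W.eisensteinTower (κ.unitTwist (-1)) hm).red k) =
      (IsLocalRing.maximalIdeal
        (IwasawaAlgebra p ⧸ Ideal.span {(PowerSeries.X ^ m + PowerSeries.C (p : ℤ_[p]) : IwasawaAlgebra p)}) ^ e k) •
        (⊤ : Submodule (IwasawaAlgebra p ⧸ Ideal.span {(PowerSeries.X ^ m + PowerSeries.C (p : ℤ_[p]) : IwasawaAlgebra p)})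
          (EisensteinLevel p m (fun j ↦ geomTorsion (W.baseChange K) ((p : ℤ) ^ j)) (k + 1 + 1))))
  (hπ : letI := IwasawaAlgebra.isLocalRing_quotient_X_pow_add_C p hm
    π ∈ IsLocalRing.maximalIdeal
      (IwasawaAlgebra p ⧸ Ideal.span {(PowerSeries.X ^ m + PowerSeries.C (p : ℤ_[p]) : IwasawaAlgebra p)}))
  (he : ∀ k, e k ≤ e (k + 1))
  (hπX : π = Ideal.Quotient.mk _ PowerSeries.X) (hek : ∀ k, e (k + 1) - e k = m)

/-- **The readout of a class satisfying Howard's `F_𝔮` at `v` satisfies the local condition of `Sel_{p^∞}(E/K_∞)` at the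
place above `v` — for a curve MULTIPLICATIVE above `p`, with NO cite-only leaf** (every finite `v`; frame: `K` imaginary quadratic,
`p` odd, `κ` anticyclotomic, Heegner hypothesis for `N ≠ 0`, `E/ℚ` with multiplicative reduction at every `v ∣ p` of `K`, `S ⊇ {v ∣ p}`
confined to `v ∣ pN` with good reduction off `S ∪ {v ∣ p}`).  Verbatim x10b-p2 g8's
`HeegnerMuPartControlGlue.eisensteinTowerReadout_of_mem_localKerOver_of_mem_eisensteinSelmerStructure` (print frame: good ordinary at `p`
+ the cite-only Greenberg leaf (CG)) with the `v ∣ p` branch replaced by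
`UniversalToricDescentTwinReadoutSelmerAtP.eisensteinTowerReadout_of_mem_localKerOver_of_hasMultiplicativeReductionAt` (Greenberg LNM 1716
p. 76 `Im λ ⊆ Im κ` at a multiplicative place, PROVED: p763876); the `v ∤ p` branches are x10b's, generic in the curve.
[cite: Howard2004HeegnerKolyvagin, Def. 2.1.10, Def. 3.1.2 and Lemma 2.2.7 / Prop. 2.2.8]
[cite: GreenbergLNM1716, §2 Prop. 2.1 and p. 76] [cite: GreenbergVatsal2000, §2 p. 17] [cite: Brink2007, Thm. 2 and Cor. 1]
[cite: Washington1997, Prop. 13.2] [cite: MilneADT2006, Ch. I Prop. 3.8] -/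
theorem eisensteinTowerReadout_of_mem_localKerOver_of_mem_eisensteinSelmerStructure_of_multiplicative
    (hK : IsImaginaryQuadratic K) (hp2 : p ≠ 2) (hκ : κ.IsAnticyclotomic) {N : ℕ}
    (hHeeg : SatisfiesHeegnerHypothesis N K) (hN0 : N ≠ 0)
    (hmultp : ∀ v : HeightOneSpectrum (𝓞 K), ((p : ℕ) : 𝓞 K) ∈ v.asIdeal →
      (W.baseChange K).HasMultiplicativeReductionAt v)
    (S : Finset (HeightOneSpectrum (𝓞 K)))
    (hbad : ∀ v, v ∉ S → ((p : ℕ) : 𝓞 K) ∉ v.asIdeal → (W.baseChange K).HasGoodReductionAt v)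
    (hSN : ∀ v ∈ S, ((p : ℕ) : 𝓞 K) ∈ v.asIdeal ∨ ((N : ℕ) : 𝓞 K) ∈ v.asIdeal)
    (v : HeightOneSpectrum (𝓞 K)) (k : ℕ)
    (c : galoisCohomology
      ((κ.unitTwist (-1)).eisensteinTwist ((W.baseChange K).torsionGaloisModule ((p : ℤ) ^ (k + 1))) hm (k + 1)) 1)
    (hc : galoisCohomology.localization
        ((κ.unitTwist (-1)).eisensteinTwist ((W.baseChange K).torsionGaloisModule ((p : ℤ) ^ (k + 1))) hm (k + 1))
        (Sum.inr v) 1 c ∈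
      (κ.unitTwist (-1)).eisensteinSelmerStructure (fun j ↦ (W.baseChange K).torsionGaloisModule ((p : ℤ) ^ j))
        (fun j ↦ (W.baseChange K).torsionGaloisModuleReduce p j) hm S
        (fun v _ ↦ (W.baseChange K).ordinaryFiltrationAt v (fun j ↦ (W.baseChange K).torsionGaloisModuleReduce p j)
          (fun _ _ ↦ rfl)) (k + 1) (Sum.inr v)) :
    letI := IwasawaAlgebra.isLocalRing_quotient_X_pow_add_C p hm
    W.eisensteinTowerReadout κ hm π e hkill hker hπ he hπX hek
        (AddCommGroup.DirectLimit.of _ _ k c :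
          AdicTower.H1A (W.eisensteinTower (κ.unitTwist (-1)) hm) π e hkill hker hπ he) ∈
      (W.baseChange K).localKerOver p κ.kerSubgroup (v.adicCompletion K) := by
  letI := IwasawaAlgebra.isLocalRing_quotient_X_pow_add_C p hm
  by_cases hpv : ((p : ℕ) : 𝓞 K) ∈ v.asIdeal
  · -- `v ∣ p`: Howard's ordinary condition ⇒ Greenberg strict ⇒ Kummer (Greenberg p. 76 at a multiplicative place, proved)
    rw [ZpExtension.eisensteinSelmerStructure_inr_of_mem _ _ _ _ _ _ _ hpv] at hc
    exact UniversalToricDescentTwinReadoutSelmerAtP.eisensteinTowerReadout_of_mem_localKerOver_of_hasMultiplicativeReductionAt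
      W κ hm π e hkill hker hπ he hπX hek hp2 v hpv (hmultp v hpv) k c hc
  · -- `v ∤ p`: `I_v ≤ ker κ` (Washington 13.2)
    have hI : inertia v ≤ κ.kerSubgroup := by
      rw [show inertia v = (adicCompletionPrime K v).inertia (absoluteGaloisGroup K) from
        (inertia_adicCompletionPrime_eq_map_absInertia K v).symm]
      exact ZpExtension.inertia_le_kerSubgroup_holds K p κ hpv (adicCompletionPrime_mem_primesAbove K v)
    by_cases hvS : v ∈ S
    · -- `v ∈ S`, `v ∤ p` (so `v ∣ N`): saturated unramified ⇒ unramified over `K_∞` ⇒ locally trivial (GV p. 17)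
      rw [ZpExtension.eisensteinSelmerStructure_inr_of_mem_of_not_mem _ _ _ _ _ _ _ hpv hvS] at hc
      have hD : ¬ decomp v ≤ κ.kerSubgroup :=
        ZpExtension.decomp_not_le_kerSubgroup_of_natCast_mem_of_satisfiesHeegnerHypothesis hK κ hκ hHeeg hN0 v hpv
          ((hSN v hvS).resolve_left hpv)
      refine Summit.BirchSwinnertonDyer.Rank1Residual.Additive.unramKer_le_localKerOver (κ := κ) (v := v)
        (W := W.baseChange K) (p := p) hI hD ?_
      rw [Summit.BirchSwinnertonDyer.Rank1Residual.X2.GreenbergVatsalTorsion.unramKer, AddMonoidHom.mem_ker]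
      exact W.eisensteinTowerReadout_resH1Hom_inertiaInToH_eq_zero_of_mem_levelCondition κ hm π e hkill hker hπ he
        hπX hek v k c hc
    · -- `v ∉ S` (good, `v ∤ p`): unramified; split completely ⇒ Milne I.3.8, else GV p. 17
      rw [ZpExtension.eisensteinSelmerStructure_inr_of_not_mem _ _ _ _ _ _ _ hpv hvS] at hc
      have hgood : (W.baseChange K).HasGoodReductionAt v := hbad v hvS hpv
      by_cases hD : decomp v ≤ κ.kerSubgroup
      · exact W.eisensteinTowerReadout_mem_localKerOver_of_decomp_le κ hm π e hkill hker hπ he hπX hek v hgood hD k c hc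
      · refine Summit.BirchSwinnertonDyer.Rank1Residual.Additive.unramKer_le_localKerOver (κ := κ) (v := v)
          (W := W.baseChange K) (p := p) hI hD ?_
        rw [Summit.BirchSwinnertonDyer.Rank1Residual.X2.GreenbergVatsalTorsion.unramKer, AddMonoidHom.mem_ker]
        exact W.eisensteinTowerReadout_resH1Hom_inertiaInToH_eq_zero_of_mem_unramifiedSubgroup κ hm π e hkill hker hπ
          he hπX hek v k c hc

end PerPlace

end Summit.BirchSwinnertonDyer.BirchSwinnertonDyer.Theorems.UniversalToricDescentTwinReadoutSelmerPerPlace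

end
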